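import Literature.Algebra.Polynomial.PolyaSzegoHalfLine
import HarnessLib

/-!
# Markov–Lukács: polynomials non-negative on a compact interval (weak / sums-of-squares form)

A real polynomial `p` which is non-negative on `[a, b]` (`a < b`) is

* `p = Σᵢ fᵢ² + (X − a)(b − X) · Σᵢ gᵢ²` with `deg fᵢ ≤ d`, `deg gᵢ ≤ d − 1` if `deg p ≤ 2d`
  (`markovLukacs_even`), and
* `p = (X − a) · Σᵢ fᵢ² + (b − X) · Σᵢ gᵢ²` with `deg fᵢ, deg gᵢ ≤ d` if `deg p ≤ 2d + 1`
  (`markovLukacs_odd`),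

with finitely many real polynomials `fᵢ, gᵢ`; conversely every polynomial of either shape is
non-negative on `[a, b]` (`eval_nonneg_of_eq_even`, `eval_nonneg_of_eq_odd`,
`markovLukacs_even_iff`, `markovLukacs_odd_iff`). Packaged with Mathlib's `IsSumSq` this is
literally Blekherman–Parrilo–Thomas, Thm 3.72 (`exists_isSumSq_even`, `exists_isSumSq_odd`): the
degree bounds are what makes non-negativity on an interval a semidefinite feasibility problem of
known size.

## Proof (Powers–Reznick, §2)

Everything is reduced to the half-line theorem `Literature.Algebra.Polynomial.polyaSzego_halfLine`
(`P ≥ 0` on `[0, ∞)`, `deg P ≤ 2S + 1` ⟹ `P = Σ fᵢ² + X Σ gᵢ²`, `deg fᵢ, gᵢ ≤ S`) by the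
**Goursat transform** of degree `m` (Powers–Reznick eq. (3)),
`goursat m f = Σₖ fₖ (1 − X)ᵏ (1 + X)^(m−k)`, i.e. `(goursat m f)(x) = (1 + x)ᵐ f((1 − x)/(1 + x))`
(`eval_goursat`). It maps polynomials non-negative on `[−1, 1]` to polynomials non-negative on
`[0, ∞)` (`goursat_eval_nonneg`, the easy half of Goursat's lemma, Powers–Reznick Lemma 1) and is
an involution up to the factor `2ᵐ` (`goursat_goursat`, Powers–Reznick eq. (4)). For `p ≥ 0` on
`[−1, 1]` with `deg p ≤ m` one writes `goursat m p = Σ fᵢ² + X Σ gᵢ²` by the half-line theorem and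
transforms back: with `y = (1 − x)/(1 + x)` one has `(1 + x)(1 + y) = 2`, hence
`2ᵐ p(x) = (1 + x)ᵐ (goursat m p)(y)`, and `(1 + x)^(2r) h(y)² = (goursat r h)(x)²`,
`(1 + x) · y = 1 − x`. For `m = 2d` the top coefficient of `goursat m p` (degree `≤ 2d`) forces
`deg gᵢ ≤ d − 1`, giving `2^(2d) p = Σ (goursat d fᵢ)² + (1 − X²) Σ (goursat (d−1) gᵢ)²`
(`markovLukacs_even_unit`); for `m = 2d + 1`,
`2^(2d+1) p = (1 + X) Σ (goursat d fᵢ)² + (1 − X) Σ (goursat d gᵢ)²` (`markovLukacs_odd_unit`).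
These polynomial identities are proved by comparing values at all `x > 0`
(`Polynomial.eq_of_infinite_eval_eq`). A general interval `[a, b]` is pulled back to `[−1, 1]`
along `x ↦ ((b − a) x + (a + b))/2` and the identity is transported by comparing values
everywhere (`Polynomial.funext`).

## What is NOT here

* The sharp forms with a *single* square in each sum (Lukács; Pólya–Szegő VI.47) resp. the
  two-square forms, and Fekete's version (Pólya–Szegő VI.46); only the weak forms with finitely
  many squares — all that semidefinite / moment duality uses — are formalised (`fekete_weak` is the
  weak form of VI.46).
* Strict positivity versions (`Pd`) of Goursat's lemma and the Bernstein / Hausdorff `(1−x)ⁱ(1+x)ʲ`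
  certificates with positive coefficients studied in the rest of Powers–Reznick.

## References

* V. Powers, B. Reznick, *Polynomials that are positive on an interval*, Trans. AMS 352 (2000)
  4677–4692, §2: eq. (3), (4), Lemma 1 (Goursat's lemma), Prop. 2, Cor. 3.
  [cite: PowersReznick2000, §2]
* G. Blekherman, P. Parrilo, R. Thomas (eds.), *Semidefinite Optimization and Convex Algebraic
  Geometry*, SIAM (2012), Thm 3.72. [cite: BlekhermanParriloThomas2012, Thm 3.72]
* G. Pólya, G. Szegő, *Problems and Theorems in Analysis II*, Springer (1976), Part VI §6,
  Problems 46 (Fekete), 47 (Lukács). [cite: PolyaSzego1976, Part VI Problems 46-47]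
-/

noncomputable section

open Polynomial Finset
open scoped BigOperators

namespace Literature.Algebra.Polynomial.MarkovLukacs

/-! ## The Goursat transform -/

/-- The **Goursat transform** of degree `m` of a real polynomial `f = Σₖ fₖ Xᵏ`:
`goursat m f = Σ_{k ≤ m} fₖ (1 − X)ᵏ (1 + X)^(m − k)`, the polynomial `(1 + X)ᵐ f((1 − X)/(1 + X))`
when `deg f ≤ m` (Powers–Reznick 2000, §2 eq. (3)). [cite: PowersReznick2000, §2 eq. (3)] -/
def goursat (m : ℕ) (f : ℝ[X]) : ℝ[X] :=
  ∑ k ∈ Finset.range (m + 1), C (f.coeff k) * (1 - X) ^ k * (1 + X) ^ (m - k)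

/-- The Goursat transform is additive. [cite: PowersReznick2000, §2 eq. (3)] -/
theorem goursat_add (m : ℕ) (f g : ℝ[X]) : goursat m (f + g) = goursat m f + goursat m g := by
  simp only [goursat, coeff_add, C_add, add_mul, Finset.sum_add_distrib]

/-- The Goursat transform commutes with scalars. [cite: PowersReznick2000, §2 eq. (3)] -/
theorem goursat_C_mul (m : ℕ) (c : ℝ) (f : ℝ[X]) :
    goursat m (C c * f) = C c * goursat m f := by
  simp only [goursat, coeff_C_mul, C_mul, Finset.mul_sum, mul_assoc]

/-- `goursat m 0 = 0`. [cite: PowersReznick2000, §2 eq. (3)] -/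
theorem goursat_zero (m : ℕ) : goursat m 0 = 0 := by
  simp [goursat]

/-- `deg (1 − X) ≤ 1`. [folklore] -/
private theorem natDegree_one_sub_X_le : (1 - X : ℝ[X]).natDegree ≤ 1 :=
  (natDegree_sub_le _ _).trans (by simp)

/-- `deg (1 + X) ≤ 1`. [folklore] -/
private theorem natDegree_one_add_X_le : (1 + X : ℝ[X]).natDegree ≤ 1 :=
  (natDegree_add_le _ _).trans (by simp)

/-- `deg (goursat m f) ≤ m`. [cite: PowersReznick2000, §2 Lemma 1] -/
theorem natDegree_goursat_le (m : ℕ) (f : ℝ[X]) : (goursat m f).natDegree ≤ m := by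
  unfold goursat
  refine natDegree_sum_le_of_forall_le _ _ fun k hk => ?_
  have hk' : k ≤ m := Nat.lt_succ_iff.mp (Finset.mem_range.mp hk)
  calc (C (f.coeff k) * (1 - X) ^ k * (1 + X) ^ (m - k)).natDegree
      ≤ (C (f.coeff k) * (1 - X) ^ k).natDegree + ((1 + X : ℝ[X]) ^ (m - k)).natDegree :=
        natDegree_mul_le
    _ ≤ k * 1 + (m - k) * 1 :=
        Nat.add_le_add
          ((natDegree_C_mul_le _ _).trans (natDegree_pow_le_of_le k natDegree_one_sub_X_le))
          (natDegree_pow_le_of_le (m - k) natDegree_one_add_X_le)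
    _ = m := by omega

/-- **Evaluation of the Goursat transform**: for `deg f ≤ m` and `1 + x ≠ 0`,
`(goursat m f)(x) = (1 + x)ᵐ · f((1 − x)/(1 + x))` (Powers–Reznick 2000, §2 eq. (3)).
[cite: PowersReznick2000, §2 eq. (3)] -/
theorem eval_goursat {m : ℕ} {f : ℝ[X]} (hf : f.natDegree ≤ m) {x : ℝ} (hx : 1 + x ≠ 0) :
    (goursat m f).eval x = (1 + x) ^ m * f.eval ((1 - x) / (1 + x)) := by
  rw [eval_eq_sum_range' (Nat.lt_succ_of_le hf) ((1 - x) / (1 + x)), Finset.mul_sum]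
  simp only [goursat, eval_finsetSum, eval_mul, eval_pow, eval_C, eval_sub, eval_add, eval_one,
    eval_X]
  refine Finset.sum_congr rfl fun k hk => ?_
  have hk' : k ≤ m := Nat.lt_succ_iff.mp (Finset.mem_range.mp hk)
  have hsplit : (1 + x) ^ m = (1 + x) ^ k * (1 + x) ^ (m - k) := by
    rw [← pow_add, Nat.add_sub_of_le hk']
  rw [hsplit, div_pow]
  field_simp

/-- **Goursat's lemma (non-negativity half).** If `deg f ≤ m` and `f ≥ 0` on `[−1, 1]` then
`goursat m f ≥ 0` on `[0, ∞)`: for `y ≥ 0`, `(1 − y)/(1 + y) ∈ (−1, 1]`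
(Powers–Reznick 2000, Lemma 1). [cite: PowersReznick2000, §2 Lemma 1] -/
theorem goursat_eval_nonneg {m : ℕ} {f : ℝ[X]} (hf : f.natDegree ≤ m)
    (hpos : ∀ x ∈ Set.Icc (-1 : ℝ) 1, 0 ≤ f.eval x) {y : ℝ} (hy : 0 ≤ y) :
    0 ≤ (goursat m f).eval y := by
  have hy1 : (0 : ℝ) < 1 + y := by linarith
  rw [eval_goursat hf hy1.ne']
  refine mul_nonneg (pow_nonneg hy1.le _) (hpos _ ⟨?_, ?_⟩)
  · rw [le_div_iff₀ hy1]; linarith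
  · rw [div_le_one hy1]; linarith

/-- **The Goursat transform is an involution up to `2ᵐ`**: for `deg f ≤ m`,
`goursat m (goursat m f) = 2ᵐ · f` (Powers–Reznick 2000, §2 eq. (4)): with `y = (1 − x)/(1 + x)`
one has `(1 − y)/(1 + y) = x` and `(1 + x)(1 + y) = 2`. [cite: PowersReznick2000, §2 eq. (4)] -/
theorem goursat_goursat {m : ℕ} {f : ℝ[X]} (hf : f.natDegree ≤ m) :
    goursat m (goursat m f) = C ((2 : ℝ) ^ m) * f := by
  apply eq_of_infinite_eval_eq
  apply (Set.Ioi_infinite (0 : ℝ)).mono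
  rintro x (hx : 0 < x)
  have h1 : (1 : ℝ) + x ≠ 0 := by positivity
  have h2 : (1 + x) * (1 + (1 - x) / (1 + x)) = 2 := by
    field_simp
    ring
  have hy1 : (1 : ℝ) + (1 - x) / (1 + x) ≠ 0 := by
    intro h
    rw [h, mul_zero] at h2
    norm_num at h2
  have hyx : (1 - (1 - x) / (1 + x)) / (1 + (1 - x) / (1 + x)) = x := by
    rw [div_eq_iff hy1]
    field_simp
    ring
  show eval x _ = eval x _
  rw [eval_goursat (natDegree_goursat_le m f) h1, eval_goursat hf hy1, hyx, eval_mul, eval_C,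
    ← mul_assoc, ← mul_pow, h2]

/-! ## Markov–Lukács on `[−1, 1]` -/

/-- **Markov–Lukács on `[−1, 1]`, even degree (weak form).** If `deg p ≤ 2d` and `p ≥ 0` on
`[−1, 1]` then `p = Σᵢ fᵢ² + (1 − X²) · Σᵢ gᵢ²` with finitely many real polynomials
`fᵢ` of degree `≤ d` and `gᵢ` of degree `≤ d − 1` (Powers–Reznick 2000, Cor. 3 and its proof;
Pólya–Szegő VI.47 (Lukács) is the sharp one-square form). [cite: PowersReznick2000, §2 Cor. 3] -/
theorem markovLukacs_even_unit (d : ℕ) (p : ℝ[X]) (hdeg : p.natDegree ≤ 2 * d)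
    (hpos : ∀ x ∈ Set.Icc (-1 : ℝ) 1, 0 ≤ p.eval x) :
    ∃ (m : ℕ) (f g : ℕ → ℝ[X]), (∀ i < m, (f i).natDegree ≤ d ∧ (g i).natDegree ≤ d - 1) ∧
      p = ∑ i ∈ Finset.range m, f i ^ 2 + (1 - X ^ 2) * ∑ i ∈ Finset.range m, g i ^ 2 := by
  cases d with
  | zero =>
    -- `p` is a non-negative constant `c = (√c)²`
    have h0 : p.natDegree = 0 := Nat.le_zero.mp (by simpa using hdeg)
    have hc : p = C (p.coeff 0) := eq_C_of_natDegree_eq_zero h0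
    have hc0 : 0 ≤ p.coeff 0 := by
      have h := hpos 0 ⟨by norm_num, by norm_num⟩
      rwa [hc, eval_C] at h
    refine ⟨1, fun _ => C (Real.sqrt (p.coeff 0)), fun _ => 0, fun i _ => ⟨by simp, by simp⟩, ?_⟩
    rw [Finset.sum_range_one, Finset.sum_range_one, ← C_pow, Real.sq_sqrt hc0, zero_pow two_ne_zero,
      mul_zero, add_zero]
    exact hc
  | succ e =>
    -- the Goursat transform `q = goursat (2e+2) p ≥ 0` on `[0, ∞)`, `deg q ≤ 2e + 2 ≤ 2(e+1) + 1`
    have hqdeg : (goursat (2 * (e + 1)) p).natDegree ≤ 2 * (e + 1) + 1 :=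
      (natDegree_goursat_le _ _).trans (Nat.le_succ _)
    have hqpos : ∀ y : ℝ, 0 ≤ y → 0 ≤ (goursat (2 * (e + 1)) p).eval y := fun y hy =>
      goursat_eval_nonneg hdeg hpos hy
    obtain ⟨m, f, g, hfg, hq⟩ := polyaSzego_halfLine (e + 1) _ hqdeg hqpos
    -- the top coefficient of `q` vanishes, hence so do the top coefficients of the `gᵢ`
    have hg0 : ∀ i ∈ Finset.range m, (g i).coeff (e + 1) = 0 := by
      have h1 : (goursat (2 * (e + 1)) p).coeff (2 * (e + 1) + 1) = 0 :=
        coeff_eq_zero_of_natDegree_lt (Nat.lt_succ_of_le (natDegree_goursat_le _ _))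
      have hF : (∑ i ∈ Finset.range m, f i ^ 2).coeff (2 * (e + 1) + 1) = 0 := by
        refine coeff_eq_zero_of_natDegree_lt (Nat.lt_succ_of_le ?_)
        exact natDegree_sum_le_of_forall_le _ _ fun i hi =>
          natDegree_pow_le_of_le 2 (hfg i (Finset.mem_range.mp hi)).1
      rw [hq, coeff_add, hF, zero_add, coeff_X_mul, finsetSum_coeff] at h1
      have h2 : ∑ i ∈ Finset.range m, ((g i).coeff (e + 1)) ^ 2 = 0 := by
        rw [← h1]
        refine Finset.sum_congr rfl fun i hi => ?_
        rw [coeff_pow_of_natDegree_le (hfg i (Finset.mem_range.mp hi)).2]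
      intro i hi
      exact (pow_eq_zero_iff two_ne_zero).mp
        ((Finset.sum_eq_zero_iff_of_nonneg fun j _ => sq_nonneg _).mp h2 i hi)
    have hgdeg : ∀ i < m, (g i).natDegree ≤ e := by
      intro i hi
      rw [natDegree_le_iff_coeff_eq_zero]
      intro N hN
      rcases (Nat.succ_le_of_lt hN).eq_or_lt with h | h
      · rw [← h]
        exact hg0 i (Finset.mem_range.mpr hi)
      · exact coeff_eq_zero_of_natDegree_lt ((hfg i hi).2.trans_lt h)
    -- the normalising constant `c = 2^{-(e+1)}`
    obtain ⟨c, hc⟩ : ∃ c : ℝ, c * c * 2 ^ (2 * (e + 1)) = 1 :=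
      ⟨(1 / 2) ^ (e + 1), by rw [pow_mul, ← mul_pow, ← mul_pow]; norm_num⟩
    refine ⟨m, fun i => C c * goursat (e + 1) (f i), fun i => C c * goursat e (g i),
      fun i hi => ⟨?_, ?_⟩, ?_⟩
    · exact (natDegree_C_mul_le _ _).trans (natDegree_goursat_le _ _)
    · exact (natDegree_C_mul_le _ _).trans ((natDegree_goursat_le _ _).trans (by omega))
    -- the identity, by comparing values at every `x > 0`
    apply eq_of_infinite_eval_eq
    apply (Set.Ioi_infinite (0 : ℝ)).mono
    rintro x (hx : 0 < x)
    have h1 : (1 : ℝ) + x ≠ 0 := by positivity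
    have h2 : (1 + x) * (1 + (1 - x) / (1 + x)) = 2 := by
      field_simp
      ring
    have hy1 : (1 : ℝ) + (1 - x) / (1 + x) ≠ 0 := by
      intro h
      rw [h, mul_zero] at h2
      norm_num at h2
    have hyx : (1 - (1 - x) / (1 + x)) / (1 + (1 - x) / (1 + x)) = x := by
      rw [div_eq_iff hy1]
      field_simp
      ring
    -- `q(y) = (1 + y)^(2e+2) p(x)` and `q(y) = Σ fᵢ(y)² + y Σ gᵢ(y)²`
    have hqy : (goursat (2 * (e + 1)) p).eval ((1 - x) / (1 + x)) =
        (1 + (1 - x) / (1 + x)) ^ (2 * (e + 1)) * p.eval x := by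
      rw [eval_goursat hdeg hy1, hyx]
    have hqy' : (goursat (2 * (e + 1)) p).eval ((1 - x) / (1 + x)) =
        ∑ i ∈ Finset.range m, (f i).eval ((1 - x) / (1 + x)) ^ 2 +
          (1 - x) / (1 + x) * ∑ i ∈ Finset.range m, (g i).eval ((1 - x) / (1 + x)) ^ 2 := by
      rw [hq]
      simp only [eval_add, eval_mul, eval_X, eval_finsetSum, eval_pow]
    have hF : ∑ i ∈ Finset.range m, (c * (goursat (e + 1) (f i)).eval x) ^ 2 =
        c * c * (1 + x) ^ (2 * (e + 1)) *
          ∑ i ∈ Finset.range m, (f i).eval ((1 - x) / (1 + x)) ^ 2 := by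
      rw [Finset.mul_sum]
      refine Finset.sum_congr rfl fun i hi => ?_
      rw [eval_goursat (hfg i (Finset.mem_range.mp hi)).1 h1]
      ring
    have hG : ∑ i ∈ Finset.range m, (c * (goursat e (g i)).eval x) ^ 2 =
        c * c * (1 + x) ^ (2 * e) *
          ∑ i ∈ Finset.range m, (g i).eval ((1 - x) / (1 + x)) ^ 2 := by
      rw [Finset.mul_sum]
      refine Finset.sum_congr rfl fun i hi => ?_
      rw [eval_goursat (hgdeg i (Finset.mem_range.mp hi)) h1]
      ring
    have hP : p.eval x =
        c * c * (1 + x) ^ (2 * (e + 1)) * (goursat (2 * (e + 1)) p).eval ((1 - x) / (1 + x)) := by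
      calc p.eval x = c * c * 2 ^ (2 * (e + 1)) * p.eval x := by rw [hc, one_mul]
        _ = c * c * ((1 + x) * (1 + (1 - x) / (1 + x))) ^ (2 * (e + 1)) * p.eval x := by rw [h2]
        _ = _ := by rw [mul_pow, hqy]; ring
    show eval x _ = eval x _
    simp only [eval_add, eval_mul, eval_finsetSum, eval_pow, eval_C, eval_sub, eval_one, eval_X]
    rw [hF, hG, hP, hqy']
    field_simp
    ring

/-- **Markov–Lukács on `[−1, 1]`, odd degree (weak form).** If `deg p ≤ 2d + 1` and `p ≥ 0` on
`[−1, 1]` then `p = (1 + X) · Σᵢ fᵢ² + (1 − X) · Σᵢ gᵢ²` with finitely many real polynomials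
`fᵢ, gᵢ` of degree `≤ d` (Powers–Reznick 2000, proof of Cor. 3; Pólya–Szegő VI.47 (Lukács) is
the sharp one-square form). [cite: PowersReznick2000, §2 Cor. 3] -/
theorem markovLukacs_odd_unit (d : ℕ) (p : ℝ[X]) (hdeg : p.natDegree ≤ 2 * d + 1)
    (hpos : ∀ x ∈ Set.Icc (-1 : ℝ) 1, 0 ≤ p.eval x) :
    ∃ (m : ℕ) (f g : ℕ → ℝ[X]), (∀ i < m, (f i).natDegree ≤ d ∧ (g i).natDegree ≤ d) ∧
      p = (1 + X) * ∑ i ∈ Finset.range m, f i ^ 2 + (1 - X) * ∑ i ∈ Finset.range m, g i ^ 2 := by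
  have hqdeg : (goursat (2 * d + 1) p).natDegree ≤ 2 * d + 1 := natDegree_goursat_le _ _
  have hqpos : ∀ y : ℝ, 0 ≤ y → 0 ≤ (goursat (2 * d + 1) p).eval y := fun y hy =>
    goursat_eval_nonneg hdeg hpos hy
  obtain ⟨m, f, g, hfg, hq⟩ := polyaSzego_halfLine d _ hqdeg hqpos
  -- the normalising constant `c = 2^{-(2d+1)/2}`
  obtain ⟨c, hc⟩ : ∃ c : ℝ, c * c * 2 ^ (2 * d + 1) = 1 := by
    refine ⟨Real.sqrt ((1 / 2) ^ (2 * d + 1)), ?_⟩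
    rw [Real.mul_self_sqrt (by positivity), ← mul_pow]
    norm_num
  refine ⟨m, fun i => C c * goursat d (f i), fun i => C c * goursat d (g i),
    fun i hi => ⟨?_, ?_⟩, ?_⟩
  · exact (natDegree_C_mul_le _ _).trans (natDegree_goursat_le _ _)
  · exact (natDegree_C_mul_le _ _).trans (natDegree_goursat_le _ _)
  apply eq_of_infinite_eval_eq
  apply (Set.Ioi_infinite (0 : ℝ)).mono
  rintro x (hx : 0 < x)
  have h1 : (1 : ℝ) + x ≠ 0 := by positivity
  have h2 : (1 + x) * (1 + (1 - x) / (1 + x)) = 2 := by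
    field_simp
    ring
  have hy1 : (1 : ℝ) + (1 - x) / (1 + x) ≠ 0 := by
    intro h
    rw [h, mul_zero] at h2
    norm_num at h2
  have hyx : (1 - (1 - x) / (1 + x)) / (1 + (1 - x) / (1 + x)) = x := by
    rw [div_eq_iff hy1]
    field_simp
    ring
  have hqy : (goursat (2 * d + 1) p).eval ((1 - x) / (1 + x)) =
      (1 + (1 - x) / (1 + x)) ^ (2 * d + 1) * p.eval x := by
    rw [eval_goursat hdeg hy1, hyx]
  have hqy' : (goursat (2 * d + 1) p).eval ((1 - x) / (1 + x)) =
      ∑ i ∈ Finset.range m, (f i).eval ((1 - x) / (1 + x)) ^ 2 +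
        (1 - x) / (1 + x) * ∑ i ∈ Finset.range m, (g i).eval ((1 - x) / (1 + x)) ^ 2 := by
    rw [hq]
    simp only [eval_add, eval_mul, eval_X, eval_finsetSum, eval_pow]
  have hF : ∑ i ∈ Finset.range m, (c * (goursat d (f i)).eval x) ^ 2 =
      c * c * (1 + x) ^ (2 * d) * ∑ i ∈ Finset.range m, (f i).eval ((1 - x) / (1 + x)) ^ 2 := by
    rw [Finset.mul_sum]
    refine Finset.sum_congr rfl fun i hi => ?_
    rw [eval_goursat (hfg i (Finset.mem_range.mp hi)).1 h1]
    ring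
  have hG : ∑ i ∈ Finset.range m, (c * (goursat d (g i)).eval x) ^ 2 =
      c * c * (1 + x) ^ (2 * d) * ∑ i ∈ Finset.range m, (g i).eval ((1 - x) / (1 + x)) ^ 2 := by
    rw [Finset.mul_sum]
    refine Finset.sum_congr rfl fun i hi => ?_
    rw [eval_goursat (hfg i (Finset.mem_range.mp hi)).2 h1]
    ring
  have hP : p.eval x =
      c * c * (1 + x) ^ (2 * d + 1) * (goursat (2 * d + 1) p).eval ((1 - x) / (1 + x)) := by
    calc p.eval x = c * c * 2 ^ (2 * d + 1) * p.eval x := by rw [hc, one_mul]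
      _ = c * c * ((1 + x) * (1 + (1 - x) / (1 + x))) ^ (2 * d + 1) * p.eval x := by rw [h2]
      _ = _ := by rw [mul_pow, hqy]; ring
  show eval x _ = eval x _
  simp only [eval_add, eval_mul, eval_finsetSum, eval_pow, eval_C, eval_sub, eval_one, eval_X]
  rw [hF, hG, hP, hqy']
  field_simp
  ring

/-- **Fekete's theorem (Pólya–Szegő VI.46), weak form.** A polynomial of degree `≤ n` which is
non-negative on `[−1, 1]` is `Σᵢ Aᵢ² + (1 − X²) Σᵢ Bᵢ²` with `deg Aᵢ ≤ n`, `deg Bᵢ ≤ n − 1`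
(Pólya–Szegő state it with one square each). [cite: PolyaSzego1976, Part VI Problem 46] -/
theorem fekete_weak (n : ℕ) (p : ℝ[X]) (hdeg : p.natDegree ≤ n)
    (hpos : ∀ x ∈ Set.Icc (-1 : ℝ) 1, 0 ≤ p.eval x) :
    ∃ (m : ℕ) (A B : ℕ → ℝ[X]), (∀ i < m, (A i).natDegree ≤ n ∧ (B i).natDegree ≤ n - 1) ∧
      p = ∑ i ∈ Finset.range m, A i ^ 2 + (1 - X ^ 2) * ∑ i ∈ Finset.range m, B i ^ 2 :=
  markovLukacs_even_unit n p (hdeg.trans (by omega)) hpos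

/-! ## Markov–Lukács on `[a, b]` -/

/-- `deg (s X + t) ≤ 1`. [folklore] -/
private theorem natDegree_affine_le (s t : ℝ) : (C s * X + C t : ℝ[X]).natDegree ≤ 1 :=
  (natDegree_add_le _ _).trans (max_le ((natDegree_C_mul_le _ _).trans natDegree_X_le) (by simp))

/-- Composing with an affine map does not raise the degree: `deg q(s X + t) ≤ deg q`. [folklore] -/
private theorem natDegree_comp_affine_le (q : ℝ[X]) (s t : ℝ) :
    (q.comp (C s * X + C t)).natDegree ≤ q.natDegree :=
  natDegree_comp_le.trans (by simpa using Nat.mul_le_mul_left q.natDegree (natDegree_affine_le s t))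

/-- **Markov–Lukács theorem, even degree (weak / sums-of-squares form).** Let `a < b`. If
`deg p ≤ 2d` and `p ≥ 0` on `[a, b]` then `p = Σᵢ fᵢ² + (X − a)(b − X) · Σᵢ gᵢ²` with finitely
many real polynomials `fᵢ` of degree `≤ d` and `gᵢ` of degree `≤ d − 1`
(Blekherman–Parrilo–Thomas 2012, Thm 3.72, even case; Powers–Reznick 2000, Cor. 3).
[cite: BlekhermanParriloThomas2012, Thm 3.72] -/
theorem markovLukacs_even {a b : ℝ} (hab : a < b) (d : ℕ) (p : ℝ[X])
    (hdeg : p.natDegree ≤ 2 * d) (hpos : ∀ x ∈ Set.Icc a b, 0 ≤ p.eval x) :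
    ∃ (m : ℕ) (f g : ℕ → ℝ[X]), (∀ i < m, (f i).natDegree ≤ d ∧ (g i).natDegree ≤ d - 1) ∧
      p = ∑ i ∈ Finset.range m, f i ^ 2 +
        (X - C a) * (C b - X) * ∑ i ∈ Finset.range m, g i ^ 2 := by
  have hba : b - a ≠ 0 := (sub_pos.mpr hab).ne'
  -- pull back to `[−1, 1]` along `φ(x) = ((b − a) x + (a + b))/2`
  have h1deg : (p.comp (C ((b - a) / 2) * X + C ((a + b) / 2))).natDegree ≤ 2 * d :=
    (natDegree_comp_affine_le p _ _).trans hdeg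
  have h1pos : ∀ x ∈ Set.Icc (-1 : ℝ) 1,
      0 ≤ (p.comp (C ((b - a) / 2) * X + C ((a + b) / 2))).eval x := by
    intro x hx
    rw [eval_comp]
    apply hpos
    simp only [eval_add, eval_mul, eval_C, eval_X]
    constructor <;> nlinarith [hx.1, hx.2, hab]
  obtain ⟨m, F, G, hFG, hrep⟩ := markovLukacs_even_unit d _ h1deg h1pos
  -- push forward along the inverse map `ψ(x) = (2x − (a + b))/(b − a)`
  refine ⟨m, fun i => (F i).comp (C (2 / (b - a)) * X + C (-(a + b) / (b - a))),
    fun i => C (2 / (b - a)) * (G i).comp (C (2 / (b - a)) * X + C (-(a + b) / (b - a))),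
    fun i hi => ⟨?_, ?_⟩, ?_⟩
  · exact (natDegree_comp_affine_le _ _ _).trans (hFG i hi).1
  · exact (natDegree_C_mul_le _ _).trans ((natDegree_comp_affine_le _ _ _).trans (hFG i hi).2)
  apply Polynomial.funext
  intro x
  have hx : p.eval x = (p.comp (C ((b - a) / 2) * X + C ((a + b) / 2))).eval
      (2 / (b - a) * x + -(a + b) / (b - a)) := by
    rw [eval_comp]
    congr 1
    simp only [eval_add, eval_mul, eval_C, eval_X]
    field_simp
    ring
  have hG : ∑ i ∈ Finset.range m,
      (2 / (b - a) * (G i).eval (2 / (b - a) * x + -(a + b) / (b - a)))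
        ^ 2 = (2 / (b - a)) ^ 2 * ∑ i ∈ Finset.range m,
      ((G i).eval (2 / (b - a) * x + -(a + b) / (b - a))) ^ 2 := by
    rw [Finset.mul_sum]
    exact Finset.sum_congr rfl fun i _ => by ring
  rw [hx, hrep]
  simp only [eval_add, eval_mul, eval_finsetSum, eval_pow, eval_sub, eval_one, eval_X, eval_C,
    eval_comp]
  rw [hG]
  field_simp
  ring

/-- **Markov–Lukács theorem, odd degree (weak / sums-of-squares form).** Let `a < b`. If
`deg p ≤ 2d + 1` and `p ≥ 0` on `[a, b]` then `p = (X − a) · Σᵢ fᵢ² + (b − X) · Σᵢ gᵢ²` with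
finitely many real polynomials `fᵢ, gᵢ` of degree `≤ d`
(Blekherman–Parrilo–Thomas 2012, Thm 3.72, odd case; Powers–Reznick 2000, Cor. 3).
[cite: BlekhermanParriloThomas2012, Thm 3.72] -/
theorem markovLukacs_odd {a b : ℝ} (hab : a < b) (d : ℕ) (p : ℝ[X])
    (hdeg : p.natDegree ≤ 2 * d + 1) (hpos : ∀ x ∈ Set.Icc a b, 0 ≤ p.eval x) :
    ∃ (m : ℕ) (f g : ℕ → ℝ[X]), (∀ i < m, (f i).natDegree ≤ d ∧ (g i).natDegree ≤ d) ∧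
      p = (X - C a) * ∑ i ∈ Finset.range m, f i ^ 2 +
        (C b - X) * ∑ i ∈ Finset.range m, g i ^ 2 := by
  have hba : b - a ≠ 0 := (sub_pos.mpr hab).ne'
  have h1deg : (p.comp (C ((b - a) / 2) * X + C ((a + b) / 2))).natDegree ≤ 2 * d + 1 :=
    (natDegree_comp_affine_le p _ _).trans hdeg
  have h1pos : ∀ x ∈ Set.Icc (-1 : ℝ) 1,
      0 ≤ (p.comp (C ((b - a) / 2) * X + C ((a + b) / 2))).eval x := by
    intro x hx
    rw [eval_comp]
    apply hpos
    simp only [eval_add, eval_mul, eval_C, eval_X]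
    constructor <;> nlinarith [hx.1, hx.2, hab]
  obtain ⟨m, F, G, hFG, hrep⟩ := markovLukacs_odd_unit d _ h1deg h1pos
  -- the normalising constant `c = √(2/(b − a))`
  obtain ⟨c, hc⟩ : ∃ c : ℝ, c * c = 2 / (b - a) :=
    ⟨Real.sqrt (2 / (b - a)), Real.mul_self_sqrt (div_pos two_pos (sub_pos.mpr hab)).le⟩
  refine ⟨m, fun i => C c * (F i).comp (C (2 / (b - a)) * X + C (-(a + b) / (b - a))),
    fun i => C c * (G i).comp (C (2 / (b - a)) * X + C (-(a + b) / (b - a))),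
    fun i hi => ⟨?_, ?_⟩, ?_⟩
  · exact (natDegree_C_mul_le _ _).trans ((natDegree_comp_affine_le _ _ _).trans (hFG i hi).1)
  · exact (natDegree_C_mul_le _ _).trans ((natDegree_comp_affine_le _ _ _).trans (hFG i hi).2)
  apply Polynomial.funext
  intro x
  have hx : p.eval x = (p.comp (C ((b - a) / 2) * X + C ((a + b) / 2))).eval
      (2 / (b - a) * x + -(a + b) / (b - a)) := by
    rw [eval_comp]
    congr 1
    simp only [eval_add, eval_mul, eval_C, eval_X]
    field_simp
    ring
  have hF : ∑ i ∈ Finset.range m,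
      (c * (F i).eval (2 / (b - a) * x + -(a + b) / (b - a))) ^ 2 =
      2 / (b - a) * ∑ i ∈ Finset.range m,
      ((F i).eval (2 / (b - a) * x + -(a + b) / (b - a))) ^ 2 := by
    rw [← hc, Finset.mul_sum]
    exact Finset.sum_congr rfl fun i _ => by ring
  have hG : ∑ i ∈ Finset.range m,
      (c * (G i).eval (2 / (b - a) * x + -(a + b) / (b - a))) ^ 2 =
      2 / (b - a) * ∑ i ∈ Finset.range m,
      ((G i).eval (2 / (b - a) * x + -(a + b) / (b - a))) ^ 2 := by
    rw [← hc, Finset.mul_sum]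
    exact Finset.sum_congr rfl fun i _ => by ring
  rw [hx, hrep]
  simp only [eval_add, eval_mul, eval_finsetSum, eval_pow, eval_sub, eval_one, eval_X, eval_C,
    eval_comp]
  rw [hF, hG]
  field_simp
  ring

/-! ## Converses and `iff` forms -/

/-- A polynomial of the shape `Σᵢ fᵢ² + (X − a)(b − X) Σᵢ gᵢ²` is non-negative on `[a, b]`
(the trivial direction of Markov–Lukács). [cite: BlekhermanParriloThomas2012, Thm 3.72] -/
theorem eval_nonneg_of_eq_even {a b : ℝ} {p : ℝ[X]} {m : ℕ} {f g : ℕ → ℝ[X]}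
    (h : p = ∑ i ∈ Finset.range m, f i ^ 2 +
      (X - C a) * (C b - X) * ∑ i ∈ Finset.range m, g i ^ 2)
    {x : ℝ} (hx : x ∈ Set.Icc a b) : 0 ≤ p.eval x := by
  rw [h]
  simp only [eval_add, eval_mul, eval_finsetSum, eval_pow, eval_sub, eval_X, eval_C]
  exact add_nonneg (Finset.sum_nonneg fun i _ => sq_nonneg _)
    (mul_nonneg (mul_nonneg (by linarith [hx.1]) (by linarith [hx.2]))
      (Finset.sum_nonneg fun i _ => sq_nonneg _))

/-- A polynomial of the shape `(X − a) Σᵢ fᵢ² + (b − X) Σᵢ gᵢ²` is non-negative on `[a, b]`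
(the trivial direction of Markov–Lukács). [cite: BlekhermanParriloThomas2012, Thm 3.72] -/
theorem eval_nonneg_of_eq_odd {a b : ℝ} {p : ℝ[X]} {m : ℕ} {f g : ℕ → ℝ[X]}
    (h : p = (X - C a) * ∑ i ∈ Finset.range m, f i ^ 2 +
      (C b - X) * ∑ i ∈ Finset.range m, g i ^ 2)
    {x : ℝ} (hx : x ∈ Set.Icc a b) : 0 ≤ p.eval x := by
  rw [h]
  simp only [eval_add, eval_mul, eval_finsetSum, eval_pow, eval_sub, eval_X, eval_C]
  exact add_nonneg (mul_nonneg (by linarith [hx.1]) (Finset.sum_nonneg fun i _ => sq_nonneg _))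
    (mul_nonneg (by linarith [hx.2]) (Finset.sum_nonneg fun i _ => sq_nonneg _))

/-- **Markov–Lukács, even degree, as an equivalence**: for `a < b` and `deg p ≤ 2d`,
`p ≥ 0` on `[a, b]` iff `p = Σᵢ fᵢ² + (X − a)(b − X) Σᵢ gᵢ²` with `deg fᵢ ≤ d`, `deg gᵢ ≤ d − 1`.
[cite: BlekhermanParriloThomas2012, Thm 3.72] -/
theorem markovLukacs_even_iff {a b : ℝ} (hab : a < b) (d : ℕ) (p : ℝ[X])
    (hdeg : p.natDegree ≤ 2 * d) :
    (∀ x ∈ Set.Icc a b, 0 ≤ p.eval x) ↔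
      ∃ (m : ℕ) (f g : ℕ → ℝ[X]), (∀ i < m, (f i).natDegree ≤ d ∧ (g i).natDegree ≤ d - 1) ∧
        p = ∑ i ∈ Finset.range m, f i ^ 2 +
          (X - C a) * (C b - X) * ∑ i ∈ Finset.range m, g i ^ 2 :=
  ⟨markovLukacs_even hab d p hdeg, fun ⟨_, _, _, _, h⟩ _ hx => eval_nonneg_of_eq_even h hx⟩

/-- **Markov–Lukács, odd degree, as an equivalence**: for `a < b` and `deg p ≤ 2d + 1`,
`p ≥ 0` on `[a, b]` iff `p = (X − a) Σᵢ fᵢ² + (b − X) Σᵢ gᵢ²` with `deg fᵢ, deg gᵢ ≤ d`.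
[cite: BlekhermanParriloThomas2012, Thm 3.72] -/
theorem markovLukacs_odd_iff {a b : ℝ} (hab : a < b) (d : ℕ) (p : ℝ[X])
    (hdeg : p.natDegree ≤ 2 * d + 1) :
    (∀ x ∈ Set.Icc a b, 0 ≤ p.eval x) ↔
      ∃ (m : ℕ) (f g : ℕ → ℝ[X]), (∀ i < m, (f i).natDegree ≤ d ∧ (g i).natDegree ≤ d) ∧
        p = (X - C a) * ∑ i ∈ Finset.range m, f i ^ 2 +
          (C b - X) * ∑ i ∈ Finset.range m, g i ^ 2 :=
  ⟨markovLukacs_odd hab d p hdeg, fun ⟨_, _, _, _, h⟩ _ hx => eval_nonneg_of_eq_odd h hx⟩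

/-! ## Sums-of-squares packaging (Blekherman–Parrilo–Thomas, Thm 3.72 verbatim) -/

/-- **BPT Thm 3.72, even case**: `a < b`, `deg p = 2d` (here `≤ 2d`), `p ≥ 0` on `[a, b]` iff
`p = s + (X − a)(b − X) · t` with `s, t` sums of squares, `deg s ≤ 2d`, `deg t ≤ 2d − 2`
(only-if direction; the converse is `eval_nonneg_of_eq_even`).
[cite: BlekhermanParriloThomas2012, Thm 3.72] -/
theorem exists_isSumSq_even {a b : ℝ} (hab : a < b) (d : ℕ) (p : ℝ[X])
    (hdeg : p.natDegree ≤ 2 * d) (hpos : ∀ x ∈ Set.Icc a b, 0 ≤ p.eval x) :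
    ∃ s t : ℝ[X], IsSumSq s ∧ IsSumSq t ∧ s.natDegree ≤ 2 * d ∧ t.natDegree ≤ 2 * d - 2 ∧
      p = s + (X - C a) * (C b - X) * t := by
  obtain ⟨m, f, g, hfg, hp⟩ := markovLukacs_even hab d p hdeg hpos
  refine ⟨_, _, IsSumSq.sum_sq (Finset.range m) f, IsSumSq.sum_sq (Finset.range m) g, ?_, ?_, hp⟩
  · exact natDegree_sum_le_of_forall_le _ _ fun i hi =>
      natDegree_pow_le_of_le 2 (hfg i (Finset.mem_range.mp hi)).1
  · refine natDegree_sum_le_of_forall_le _ _ fun i hi => ?_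
    exact (natDegree_pow_le_of_le 2 (hfg i (Finset.mem_range.mp hi)).2).trans (by omega)

/-- **BPT Thm 3.72, odd case**: `a < b`, `deg p = 2d + 1` (here `≤ 2d + 1`), `p ≥ 0` on `[a, b]`
iff `p = (X − a) · s + (b − X) · t` with `s, t` sums of squares, `deg s, deg t ≤ 2d`
(only-if direction; the converse is `eval_nonneg_of_eq_odd`).
[cite: BlekhermanParriloThomas2012, Thm 3.72] -/
theorem exists_isSumSq_odd {a b : ℝ} (hab : a < b) (d : ℕ) (p : ℝ[X])
    (hdeg : p.natDegree ≤ 2 * d + 1) (hpos : ∀ x ∈ Set.Icc a b, 0 ≤ p.eval x) :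
    ∃ s t : ℝ[X], IsSumSq s ∧ IsSumSq t ∧ s.natDegree ≤ 2 * d ∧ t.natDegree ≤ 2 * d ∧
      p = (X - C a) * s + (C b - X) * t := by
  obtain ⟨m, f, g, hfg, hp⟩ := markovLukacs_odd hab d p hdeg hpos
  refine ⟨_, _, IsSumSq.sum_sq (Finset.range m) f, IsSumSq.sum_sq (Finset.range m) g, ?_, ?_, hp⟩
  · exact natDegree_sum_le_of_forall_le _ _ fun i hi =>
      natDegree_pow_le_of_le 2 (hfg i (Finset.mem_range.mp hi)).1
  · exact natDegree_sum_le_of_forall_le _ _ fun i hi =>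
      natDegree_pow_le_of_le 2 (hfg i (Finset.mem_range.mp hi)).2

end Literature.Algebra.Polynomial.MarkovLukacs

end
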